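import Mathlib
import HarnessLib
import Summits.Ventures.LatticeQCDFlow.Exactness.PTBCWilsonDefect
import Summits.Ventures.LatticeQCDFlow.Exactness.SUNMultiStepLeapfrogHMCEngine
import Summits.Ventures.LatticeQCDFlow.TrivializingMaps.HaarFibreAverages
import Summits.Ventures.LatticeQCDFlow.Exactness.CompactHaar

/-!
# Open boundary conditions in time as the engine runs them: the plaquette-weighted Wilson action on the periodic lattice is blind to the wrap-around temporal links, gauge invariant, and its HMC converges

HONEST FRAMING: exact (Metropolis-corrected) sampling algorithms for lattice gauge theory;
figures of merit are autocorrelation/cost numbers at stated couplings and volumes; no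
continuum-physics claim.

Venture `LatticeQCDFlow` (cell pub-lqcd), topic `Exactness`, FANOUT row 21 (`su3-base`: the row's THIRD baseline
arm is `OBC-HMC` — HMC with OPEN boundary conditions in time, the non-flow remedy for topological freezing of the
cell's T2 list; the engine realises it on the PERIODIC lattice through plaquette weights, `latflow.core.gauge4d`:
"Wilson action `S = β Σ_p w_p (1 − Re tr U_p/N)` (`w_p = 1` unless plaquette weights are set)", every update
honouring the weights).  NEW WORK of the cell over the tree (`PTBCWilsonDefect.lean`, row 9: the weighted action
`weightedWilsonAction w ρ`, `continuous_weightedWilsonAction`, `weightedWilsonAction_bounded`;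
`SUNMultiStepLeapfrogHMCEngine.lean`: the engine's `n`-step HMC is uniformly ergodic for every bounded measurable
action; the Literature torus objects `Site`, `Edge`, `Plaquette`, `plaquetteHolonomy`, `gaugeTransform` of
`ConstructiveQFTWave0`, used by name).  Nothing is cited as a fact; no number.  Printed counterpart, NAMED ONLY:
Lüscher–Schaefer, JHEP 07 (2011) 036, §2.1 (open boundary conditions: the temporal links leaving the last time-slice
are absent; spatial plaquettes on the two boundary slices carry weight `½ c_G`).

## The object (time direction `τ : Fin d`, torus `(ℤ/L)^d`, boundary slices `x_τ = 0` and `x_τ = L − 1 ≡ −1`)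

* `obcWeight τ p` — `0` on the TEMPORAL plaquettes based on the last slice (`τ ∈ {i, j}`, `x_τ = −1`: exactly the
  plaquettes through a wrap-around temporal link), `½` on the SPATIAL plaquettes of the two boundary slices, `1`
  elsewhere (`c_G = 1`); the DEAD links are `e = (x, τ)` with `x_τ = −1` (the links the open lattice does not
  have; hypotheses `e.2 = τ`, `e.1 τ = −1` below); `obcAction τ ρ = weightedWilsonAction (obcWeight τ) ρ`.

## What is proved (any group `G`, any representation `ρ`, every `d`, `L ≥ 1`)

* `plaquetteEdges_spec` / **`obcWeight_eq_zero_of_dead_mem`** — a plaquette containing a dead link is a temporal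
  plaquette based on the last slice, so its weight is `0` (the shift `x + ĵ` does not move `x_τ` for `j ≠ τ`);
  `plaquetteHolonomy_update_of_not_mem` — a plaquette not containing `e` does not see an update of `e`;
* **`obcAction_update_dead`** — `S_OBC(U with a dead link replaced by anything) = S_OBC(U)`: the engine's periodic
  bookkeeping IS the open lattice's action (the dead links are spectators);
* **`weightedWilsonAction_gaugeTransform`** — every plaquette-weighted Wilson action (OBC, the PTBC defect of rows
  22–24, anything) is gauge invariant; `obcAction_gaugeTransform`;
* **`obc_sunLeapfrogHMCN_uniformlyErgodic`** — `G = SU(N)`, continuous `ρ`, any real `β`: the engine's `n`-step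
  leapfrog HMC (`SUNMultiStepLeapfrogHMCEngine`, any measurable momentum increment bounded by `b` and
  `K_g`-Lipschitz, short trajectories) on the action `β S_OBC` converges to `Z⁻¹ e^{−β S_OBC} · Haar^{⊗ edges}` from
  EVERY initial law, geometrically in total variation; `obc_sunLeapfrogHMCN_invariant_unique`.

* **`obcGibbs_inter_deadLink_eq`** — compact second-countable `G`, continuous `ρ`: under `Z⁻¹e^{−βS_OBC}·Haar^⊗`,
  for every dead link `e`, `P(A ∩ {U_e ∈ B}) = P(A)·Haar(B)` for every event `A` not reading `e` — THE DEAD LINKS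
  ARE INDEPENDENT HAAR SPECTATORS: the engine's periodic bookkeeping with zero wrap weights is the open lattice
  (`lintegral_piHaar_eq_fibre`: the one-link fibre identity of the product Haar law for measurable integrands).

NOT CLAIMED: the boundary improvement coefficient `c_G ≠ 1`; anything about topological charge, its non-quantisation or autocorrelations with open
boundaries (MEASURED by row 21's arm, not a theorem); the OBC force / heat bath with weighted staples; floating point.
-/

noncomputable section

namespace Summit.Ventures.LatticeQCDFlow.Exactness

open MeasureTheory Set Function
open Literature.MathematicalPhysics.QuantumFieldTheory
open scoped ENNReal Matrix Matrix.Norms.Operator NNReal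

set_option backward.isDefEq.respectTransparency false

/-! ## §1 The open-boundary weights and the dead links -/

section Weights

variable {d L : ℕ}

/-- **The open-boundary plaquette weights** (time direction `τ`, `c_G = 1`): `0` on temporal plaquettes based on the
last slice `x_τ = −1`, `½` on spatial plaquettes of the boundary slices `x_τ ∈ {0, −1}`, `1` elsewhere. -/
def obcWeight (τ : Fin d) (p : Plaquette d L) : ℝ :=
  if p.2.1.1 = τ ∨ p.2.1.2 = τ then (if p.1 τ = -1 then 0 else 1)
  else (if p.1 τ = -1 ∨ p.1 τ = 0 then 1 / 2 else 1)

/-- The four links of the plaquette `(x; i, j)`: `(x, i)`, `(x + î, j)`, `(x + ĵ, i)`, `(x, j)`. -/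
def plaquetteEdges (p : Plaquette d L) : Finset (Edge d L) :=
  {(p.1, p.2.1.1), (p.1.shift p.2.1.1, p.2.1.2), (p.1.shift p.2.1.2, p.2.1.1), (p.1, p.2.1.2)}

/-- Membership in `plaquetteEdges`, spelled out. -/
theorem mem_plaquetteEdges {p : Plaquette d L} {e : Edge d L} :
    e ∈ plaquetteEdges p ↔ e = (p.1, p.2.1.1) ∨ e = (p.1.shift p.2.1.1, p.2.1.2) ∨
      e = (p.1.shift p.2.1.2, p.2.1.1) ∨ e = (p.1, p.2.1.2) := by
  simp [plaquetteEdges]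

/-- A shift along `j ≠ τ` does not move the time coordinate. -/
theorem shift_apply_of_ne (x : Site d L) {j τ : Fin d} (h : j ≠ τ) : (x.shift j) τ = x τ := by
  rw [Site.shift, Pi.add_apply, Pi.single_eq_of_ne (Ne.symm h), add_zero]

/-- **A plaquette through a dead link has weight zero**: it is a temporal plaquette based on the last slice. -/
theorem obcWeight_eq_zero_of_dead_mem (τ : Fin d) {p : Plaquette d L} {e : Edge d L} (he2 : e.2 = τ)
    (he1 : e.1 τ = -1) (hmem : e ∈ plaquetteEdges p) : obcWeight τ p = 0 := by
  obtain ⟨x, ⟨⟨i, j⟩, hij⟩⟩ := p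
  simp only [mem_plaquetteEdges] at hmem
  have hij' : i ≠ j := ne_of_lt hij
  -- in each of the four cases the plaquette is temporal and `x_τ = −1`
  have key : (i = τ ∨ j = τ) ∧ x τ = -1 := by
    rcases hmem with h | h | h | h <;> rw [h] at he2 he1 <;> simp only at he2 he1
    · exact ⟨Or.inl he2, he1⟩
    · subst he2
      exact ⟨Or.inr rfl, by rwa [shift_apply_of_ne x hij'] at he1⟩
    · subst he2
      exact ⟨Or.inl rfl, by rwa [shift_apply_of_ne x (Ne.symm hij')] at he1⟩
    · exact ⟨Or.inr he2, he1⟩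
  simp only [obcWeight, key.1, if_true, key.2]

/-- A plaquette that does not contain the link `e` does not see an update of `e`. -/
theorem plaquetteHolonomy_update_of_not_mem {G : Type*} [Group G] (U : GaugeConfig d L G) {p : Plaquette d L}
    {e : Edge d L} (hmem : e ∉ plaquetteEdges p) (h : G) :
    plaquetteHolonomy (Function.update U e h) p.1 p.2.1.1 p.2.1.2 = plaquetteHolonomy U p.1 p.2.1.1 p.2.1.2 := by
  simp only [mem_plaquetteEdges, not_or] at hmem
  obtain ⟨h1, h2, h3, h4⟩ := hmem
  unfold plaquetteHolonomy
  rw [Function.update_of_ne (Ne.symm h1), Function.update_of_ne (Ne.symm h2), Function.update_of_ne (Ne.symm h3),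
    Function.update_of_ne (Ne.symm h4)]

end Weights

/-! ## §2 The open-boundary action: blind to the dead links, gauge invariant -/

section Action

variable {d L N : ℕ} [NeZero L] {G : Type*} [Group G] (ρ : G →* Matrix (Fin N) (Fin N) ℂ)

/-- **The open-boundary Wilson action** as the engine computes it on the periodic lattice:
`S_OBC = Σ_p w_p (N − Re tr ρ(U_p))` with the weights `obcWeight τ`. -/
def obcAction (τ : Fin d) (U : GaugeConfig d L G) : ℝ := weightedWilsonAction (obcWeight τ) ρ U

/-- **THE DEAD LINKS ARE SPECTATORS**: replacing a dead link by any group element does not change `S_OBC`. -/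
theorem obcAction_update_dead (τ : Fin d) (U : GaugeConfig d L G) {e : Edge d L} (he2 : e.2 = τ)
    (he1 : e.1 τ = -1) (h : G) :
    obcAction ρ τ (Function.update U e h) = obcAction ρ τ U := by
  unfold obcAction weightedWilsonAction
  refine Finset.sum_congr rfl fun p _ => ?_
  by_cases hmem : e ∈ plaquetteEdges p
  · rw [obcWeight_eq_zero_of_dead_mem τ he2 he1 hmem, zero_mul, zero_mul]
  · rw [plaquetteHolonomy_update_of_not_mem U hmem h]

/-- **Every plaquette-weighted Wilson action is gauge invariant** (the holonomy transforms by conjugation at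
its base point and the trace is cyclic) — the OBC weights, the PTBC defect weights, anything. -/
theorem weightedWilsonAction_gaugeTransform (w : Plaquette d L → ℝ) (g : Site d L → G) (U : GaugeConfig d L G) :
    weightedWilsonAction w ρ (gaugeTransform g U) = weightedWilsonAction w ρ U := by
  have hshift : ∀ (x : Site d L) (i j : Fin d), (x.shift i).shift j = (x.shift j).shift i :=
    fun x i j => by simp only [Site.shift, add_assoc, add_comm (Pi.single (M := fun _ => ZMod L) i 1)]
  have hhol : ∀ (x : Site d L) (i j : Fin d), plaquetteHolonomy (gaugeTransform g U) x i j =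
      g x * plaquetteHolonomy U x i j * (g x)⁻¹ := fun x i j => by
    simp only [plaquetteHolonomy, gaugeTransform, hshift x j i, mul_inv_rev, inv_inv]
    group
  have htr : ∀ (a b : G), (ρ (a * b * a⁻¹)).trace = (ρ b).trace := fun a b => by
    rw [map_mul, map_mul, Matrix.trace_mul_cycle, ← map_mul, inv_mul_cancel, map_one, one_mul]
  simp only [weightedWilsonAction, hhol, htr]

/-- The open-boundary action is gauge invariant. -/
theorem obcAction_gaugeTransform (τ : Fin d) (g : Site d L → G) (U : GaugeConfig d L G) :
    obcAction ρ τ (gaugeTransform g U) = obcAction ρ τ U :=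
  weightedWilsonAction_gaugeTransform ρ (obcWeight τ) g U

variable [TopologicalSpace G] [IsTopologicalGroup G]

/-- The open-boundary action is continuous (continuous representation). -/
theorem continuous_obcAction (hρ : Continuous ρ) (τ : Fin d) : Continuous (obcAction (d := d) (L := L) ρ τ) :=
  continuous_weightedWilsonAction (obcWeight τ) ρ hρ

/-- On a compact group `β S_OBC` is bounded. -/
theorem exists_bound_smul_obcAction [CompactSpace G] (hρ : Continuous ρ) (τ : Fin d) (β : ℝ) :
    ∃ s : ℝ, ∀ U : GaugeConfig d L G, |β * obcAction ρ τ U| ≤ s := by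
  have hc : Continuous fun U : GaugeConfig d L G => |β * obcAction ρ τ U| :=
    continuous_abs.comp (continuous_const.mul (continuous_obcAction ρ hρ τ))
  obtain ⟨C, hC⟩ := isCompact_univ.exists_bound_of_continuousOn hc.continuousOn
  exact ⟨C, fun U => le_trans (le_abs_self _) ((Real.norm_eq_abs _).symm.le.trans (hC U (mem_univ U)))⟩

end Action

/-! ## §3 The engine's HMC on the open-boundary action converges -/

section HMC

variable (N : ℕ) [NeZero N] {d L M : ℕ} [NeZero L] (ρ : Matrix.specialUnitaryGroup (Fin N) ℂ →* Matrix (Fin M) (Fin M) ℂ)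
  {ε : ℝ} {nstep : ℕ} {b Kg : ℝ}

/-- **THE ENGINE'S `n`-STEP LEAPFROG HMC ON THE OPEN-BOUNDARY ACTION CONVERGES FROM EVERY START** (short
trajectories): `G = SU(N)`, continuous `ρ`, any real `β`, any time direction `τ`, ANY measurable momentum increment
bounded by `b ≥ 0` and `K_g`-Lipschitz in the matrix sup norm, Metropolis test on `β S_OBC + T`; IF
`nε, (2n+1)b, K_g εn² ≤ s_N`: there are `k` and `δ ∈ (0, 1]` with
`|μ₀Kᵗ(A) − (Z⁻¹e^{−βS_OBC}·Haar^⊗)(A)| ≤ (1 − δ)^{⌊t/(k+1)⌋}` for EVERY initial law `μ₀`, every `t`, every `A`. -/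
theorem obc_sunLeapfrogHMCN_uniformlyErgodic (hρ : Continuous ρ) (τ : Fin d) (β : ℝ) (hε : 0 < ε) (hn : 1 ≤ nstep)
    {g : GaugeConfig d L (Matrix.specialUnitaryGroup (Fin N) ℂ) → Edge d L → SUNCoords N}
    (hg : Measurable g) (hb0 : 0 ≤ b) (hb : ∀ U e, ‖g U e‖ ≤ b) (hK0 : 0 ≤ Kg)
    (hK : ∀ U U', ‖g U - g U'‖ ≤ Kg * ‖coeConfig U - coeConfig U'‖)
    (h1 : nstep * ε ≤ sunShortTrajThreshold (sunCoordι N) (sunCoordι_injective N))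
    (h2 : (2 * nstep + 1) * b ≤ sunShortTrajThreshold (sunCoordι N) (sunCoordι_injective N))
    (h3 : Kg * ε * (nstep : ℝ) ^ 2 ≤ sunShortTrajThreshold (sunCoordι N) (sunCoordι_injective N)) :
    ∃ k : ℕ, ∃ δ : ℝ, 0 < δ ∧ δ ≤ 1 ∧
      ∀ (μ₀ : Measure (GaugeConfig d L (Matrix.specialUnitaryGroup (Fin N) ℂ))) [IsProbabilityMeasure μ₀]
        (t : ℕ) (A : Set (GaugeConfig d L (Matrix.specialUnitaryGroup (Fin N) ℂ))),
        |((fun m : Measure (GaugeConfig d L (Matrix.specialUnitaryGroup (Fin N) ℂ)) =>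
              m.bind (sunLeapfrogHMCN (sunCoordι N) (sunCoordι_skew N) ε (Measure.addHaar : Measure (SUNCoords N))
                (sunKinetic N) hg (fun U => β * obcAction ρ τ U) nstep))^[t] μ₀).real A
            - (gibbsProbability (Measure.pi fun _ : Edge d L => haarProbability (Matrix.specialUnitaryGroup (Fin N) ℂ))
                (fun U => Real.exp (-(β * obcAction ρ τ U)))).real A| ≤ (1 - δ) ^ (t / (k + 1)) := by
  obtain ⟨s, hs⟩ := exists_bound_smul_obcAction (d := d) (L := L) ρ hρ τ β
  exact engine_sunLeapfrogHMCN_uniformlyErgodic N hε hn hg hb0 hb hK0 hK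
    ((continuous_obcAction ρ hρ τ).const_smul β |>.measurable) hs h1 h2 h3

/-- **… and `Z⁻¹e^{−βS_OBC}·Haar^⊗` is its ONLY invariant probability law.** -/
theorem obc_sunLeapfrogHMCN_invariant_unique (hρ : Continuous ρ) (τ : Fin d) (β : ℝ) (hε : 0 < ε) (hn : 1 ≤ nstep)
    {g : GaugeConfig d L (Matrix.specialUnitaryGroup (Fin N) ℂ) → Edge d L → SUNCoords N}
    (hg : Measurable g) (hb0 : 0 ≤ b) (hb : ∀ U e, ‖g U e‖ ≤ b) (hK0 : 0 ≤ Kg)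
    (hK : ∀ U U', ‖g U - g U'‖ ≤ Kg * ‖coeConfig U - coeConfig U'‖)
    (h1 : nstep * ε ≤ sunShortTrajThreshold (sunCoordι N) (sunCoordι_injective N))
    (h2 : (2 * nstep + 1) * b ≤ sunShortTrajThreshold (sunCoordι N) (sunCoordι_injective N))
    (h3 : Kg * ε * (nstep : ℝ) ^ 2 ≤ sunShortTrajThreshold (sunCoordι N) (sunCoordι_injective N))
    {π' : Measure (GaugeConfig d L (Matrix.specialUnitaryGroup (Fin N) ℂ))} [IsProbabilityMeasure π']
    (hπ' : ProbabilityTheory.Kernel.Invariant (sunLeapfrogHMCN (sunCoordι N) (sunCoordι_skew N) ε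
      (Measure.addHaar : Measure (SUNCoords N)) (sunKinetic N) hg (fun U => β * obcAction ρ τ U) nstep) π') :
    π' = gibbsProbability (Measure.pi fun _ : Edge d L => haarProbability (Matrix.specialUnitaryGroup (Fin N) ℂ))
      (fun U => Real.exp (-(β * obcAction ρ τ U))) := by
  obtain ⟨s, hs⟩ := exists_bound_smul_obcAction (d := d) (L := L) ρ hρ τ β
  exact engine_sunLeapfrogHMCN_invariant_unique N hε hn hg hb0 hb hK0 hK
    ((continuous_obcAction ρ hρ τ).const_smul β |>.measurable) hs h1 h2 h3 hπ'

end HMC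

/-! ## §4 Under the open-boundary Gibbs law the dead links are Haar-distributed and independent of everything else -/

section DeadLinks

variable {d L N : ℕ} [NeZero L] {G : Type*} [Group G] [TopologicalSpace G] [IsTopologicalGroup G] [CompactSpace G]
  [MeasurableSpace G] [BorelSpace G] [SecondCountableTopology G] (ρ : G →* Matrix (Fin N) (Fin N) ℂ)

omit [NeZero L] [TopologicalSpace G] [IsTopologicalGroup G] [CompactSpace G] [MeasurableSpace G] [BorelSpace G]
  [SecondCountableTopology G] in
/-- `mulSingle e h · U` is the update of the link `e` to `h · U_e`. -/
theorem mulSingle_mul_eq_update (U : GaugeConfig d L G) (e : Edge d L) (h : G) :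
    Pi.mulSingle e h * U = Function.update U e (h * U e) := by
  funext e'
  by_cases he : e' = e
  · subst he; simp
  · rw [Pi.mul_apply, Pi.mulSingle_eq_of_ne he, one_mul, Function.update_of_ne he]

/-- **The fibre identity along one link** for the product Haar probability (left invariance + Tonelli):
`∫⁻ F dHaar^⊗ = ∫⁻ dHaar^⊗(U) ∫⁻ dHaar(h) F(mulSingle e h · U)` for every measurable `F ≥ 0`. -/
theorem lintegral_piHaar_eq_fibre (e : Edge d L) {F : GaugeConfig d L G → ℝ≥0∞} (hF : Measurable F) :
    ∫⁻ U, F U ∂(Measure.pi fun _ : Edge d L => haarProbability G)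
      = ∫⁻ U, ∫⁻ h, F (Pi.mulSingle e h * U) ∂(haarProbability G)
          ∂(Measure.pi fun _ : Edge d L => haarProbability G) := by
  have hinv : ∀ h : G, ∫⁻ U, F (Pi.mulSingle e h * U) ∂(Measure.pi fun _ : Edge d L => haarProbability G)
      = ∫⁻ U, F U ∂(Measure.pi fun _ : Edge d L => haarProbability G) := fun h =>
    lintegral_mul_left_eq_self F (Pi.mulSingle e h)
  have hmeas : Measurable (Function.uncurry fun (h : G) (U : GaugeConfig d L G) => F (Pi.mulSingle e h * U)) :=
    hF.comp (TrivializingMaps.continuous_mulSingle_mul e).measurable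
  calc ∫⁻ U, F U ∂(Measure.pi fun _ : Edge d L => haarProbability G)
      = ∫⁻ h, ∫⁻ U, F (Pi.mulSingle e h * U) ∂(Measure.pi fun _ : Edge d L => haarProbability G) ∂(haarProbability G) := by
        simp_rw [hinv]; rw [lintegral_const, measure_univ, mul_one]
    _ = ∫⁻ U, ∫⁻ h, F (Pi.mulSingle e h * U) ∂(haarProbability G) ∂(Measure.pi fun _ : Edge d L => haarProbability G) :=
        lintegral_lintegral_swap hmeas.aemeasurable

/-- **THE DEAD LINKS ARE HAAR NOISE**: under the open-boundary Gibbs law `Z⁻¹ e^{−β S_OBC} · Haar^{⊗ edges}`, for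
every dead link `e`, every measurable `B ⊆ G` and every measurable event `A` that does not read the link `e`,
`P(A ∩ {U_e ∈ B}) = P(A) · Haar(B)` — the link is Haar-distributed and independent of all the others (so the
periodic bookkeeping with zero wrap weights IS the open lattice, times independent Haar spectators). -/
theorem obcGibbs_inter_deadLink_eq (hρ : Continuous ρ) (τ : Fin d) (β : ℝ) {e : Edge d L} (he2 : e.2 = τ)
    (he1 : e.1 τ = -1) {A : Set (GaugeConfig d L G)} (hA : MeasurableSet A)
    (hAe : ∀ U h, Function.update U e h ∈ A ↔ U ∈ A) {B : Set G} (hB : MeasurableSet B) :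
    gibbsProbability (Measure.pi fun _ : Edge d L => haarProbability G) (fun U => Real.exp (-(β * obcAction ρ τ U)))
        (A ∩ {U | U e ∈ B})
      = gibbsProbability (Measure.pi fun _ : Edge d L => haarProbability G) (fun U => Real.exp (-(β * obcAction ρ τ U))) A
          * haarProbability G B := by
  set w : GaugeConfig d L G → ℝ≥0∞ := fun U => ENNReal.ofReal (Real.exp (-(β * obcAction ρ τ U))) with hw
  have hwm : Measurable w :=
    ENNReal.measurable_ofReal.comp (Real.measurable_exp.comp
      (((continuous_obcAction ρ hρ τ).measurable.const_mul β).neg))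
  have hE : MeasurableSet {U : GaugeConfig d L G | U e ∈ B} := measurable_pi_apply e hB
  -- along the fibre of `e` the integrand factorises: `A` and `w` do not read the link, `B` reads only it
  have hpt : ∀ (U : GaugeConfig d L G) (h : G),
      (A ∩ {U : GaugeConfig d L G | U e ∈ B}).indicator w (Pi.mulSingle e h * U)
        = A.indicator w U * B.indicator 1 (h * U e) := by
    intro U h
    rw [mulSingle_mul_eq_update]
    have hwU : w (Function.update U e (h * U e)) = w U := by
      simp only [hw, obcAction_update_dead ρ τ U he2 he1]
    have hmemE : Function.update U e (h * U e) ∈ {U : GaugeConfig d L G | U e ∈ B} ↔ h * U e ∈ B := by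
      simp only [Set.mem_setOf_eq, Function.update_self]
    by_cases hU : U ∈ A
    · by_cases hh : h * U e ∈ B
      · rw [Set.indicator_of_mem (Set.mem_inter ((hAe U _).2 hU) (hmemE.2 hh)), Set.indicator_of_mem hU,
          Set.indicator_of_mem hh, Pi.one_apply, mul_one, hwU]
      · rw [Set.indicator_of_notMem (fun hm => hh (hmemE.1 hm.2)), Set.indicator_of_notMem hh, mul_zero]
    · rw [Set.indicator_of_notMem (fun hm => hU ((hAe U _).1 hm.1)), Set.indicator_of_notMem hU, zero_mul]
  -- the inner Haar integral over the link: `∫ 1_B(h U_e) dHaar(h) = Haar(B)` (right invariance)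
  have hinner : ∀ U : GaugeConfig d L G,
      ∫⁻ h, A.indicator w U * B.indicator 1 (h * U e) ∂(haarProbability G) = A.indicator w U * haarProbability G B := by
    intro U
    have hm : Measurable fun h : G => B.indicator (1 : G → ℝ≥0∞) (h * U e) :=
      (measurable_one.indicator hB).comp (measurable_mul_const (U e))
    rw [lintegral_const_mul _ hm,
      lintegral_mul_right_eq_self (fun h : G => B.indicator (1 : G → ℝ≥0∞) h) (U e), lintegral_indicator_one hB]
  have key : (Measure.pi fun _ : Edge d L => haarProbability G).withDensity w (A ∩ {U | U e ∈ B})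
      = (Measure.pi fun _ : Edge d L => haarProbability G).withDensity w A * haarProbability G B := by
    rw [withDensity_apply _ (hA.inter hE), withDensity_apply _ hA, ← lintegral_indicator (hA.inter hE),
      ← lintegral_indicator hA, lintegral_piHaar_eq_fibre e (hwm.indicator (hA.inter hE))]
    simp_rw [hpt, hinner]
    rw [lintegral_mul_const _ (hwm.indicator hA)]
  simp only [gibbsProbability, Measure.smul_apply, smul_eq_mul]
  change _ * (Measure.pi fun _ : Edge d L => haarProbability G).withDensity w (A ∩ {U | U e ∈ B}) =
    _ * (Measure.pi fun _ : Edge d L => haarProbability G).withDensity w A * haarProbability G B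
  rw [key, mul_assoc]

end DeadLinks

end Summit.Ventures.LatticeQCDFlow.Exactness
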